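import Summits.QuantumFields.YangMills.Theorems.DiagonalMirrorRPRWilsonDiagonalModelResum
import Summits.QuantumFields.YangMills.Theorems.DiagonalMirrorRPRWilsonDiagonalModelLiftedKernel

/-!
# Crux `DiagonalMirrorRPR` (stmt-QuantumFields-10604), line `sign-twisted-diagonal-trace`, construction F1_diag
# (director-ym O4 WORD 3 (A)), S4c: RESUMMATION OF THE PAIR-CHAIN INTEGRAND through the feature lift

Helper for the crux `DiagonalMirrorRPR` of `YangMills` (routes `IsotropyFromPowerCounting`, `MirrorModularBoosts`,
`PencilRigidity`; item stmt-QuantumFields-10604), attached `--supports … --as helper`; it closes nothing by itself.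
Continuation of `…WilsonDiagonalModelResum` (finite products of absolutely convergent series, `hasSum_pi_prod_natFeature_mul`) and
`…LiftedKernel` (`hasSum_expFeature_even`, `evenActionU_thetaHalf_eq_sum_bondVec`).

* `hasSum_pi_prod_fintype` — `Σ_{k ∈ ℕ^ι} ∏_i f_i(k_i) = ∏_i c_i` over an arbitrary finite index type `ι` (transport along
  `Fintype.equivFin` and `Equiv.piCongrLeft'`);
* ★ **`hasSum_chainIntegrand`** — for `β ≥ 0`, unitary `ρ`, any finite `ι` with a "next" map `σ` (e.g. `ι = ℤ_m`, `σ t = t+1`) and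
  half-layer data `Y X : ι → HalfCfg`:
  `∏_i e^{β even(Y_i,X_i,Y_{σ i})} e^{β odd(X_i,Y_{σ i},X_{σ i})} = Σ_{k ∈ ℕ^ι} ∏_i e^{β inslab X_i} ψ_{k_i}(w(ΘY_{σ i})) ψ_{k_i}(w(Y_i)) e^{β odd(X_i,Y_{σ i},X_{σ i})}`
  (a `HasSum`).  With `…PairChain.diagCyclicTraceU_eq_integral_pairs` the left side integrates to `diagCyclicTraceU ρ β m`; the
  right side is, after the `Y`-integrations (Tonelli, OWED), the cyclic `m`-fold integral of the lifted kernel `𝔞 = natKernel ρ β`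
  over `(count ⊗ halfHaar)^m` — the path-integral half of the trace formulas `Σ κ_i^m = diagCyclicTraceU ρ β m`.

HONEST FRAMING: construction helper; no `def wilsonDiagonalModel`; nothing about D_old ⟨10604⟩, the RP crux of the FOLD restate,
or the summit is proved; the Yang–Mills mass gap is NOT proved here or anywhere in the tree.
-/

set_option autoImplicit false

noncomputable section

open scoped BigOperators
open MeasureTheory
open Literature.MathematicalPhysics.QuantumLattice Literature.MathematicalPhysics.QuantumFieldTheory
open Summit.QuantumFields.YangMills.Cruxes.DiagonalMirrorRPR.ParityBridgeColdTraces

namespace Summit.QuantumFields.YangMills.Cruxes.DiagonalMirrorRPR.SignTwistedDiagonalTrace.WilsonDiagonal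

/-! ## §23 Finite products of absolutely convergent series over an arbitrary finite index type -/

section FintypeProd

/-- `Σ_{k ∈ ℕ^ι} ∏_i f_i(k_i) = ∏_i c_i` for a finite index type `ι` (transport of `hasSum_pi_prod` along `Fintype.equivFin`). -/
theorem hasSum_pi_prod_fintype {ι : Type*} [Fintype ι] {f : ι → ℕ → ℝ} {c : ι → ℝ} (hf : ∀ i, HasSum (f i) (c i))
    (hn : ∀ i, Summable fun k => ‖f i k‖) :
    HasSum (fun k : ι → ℕ => ∏ i, f i (k i)) (∏ i, c i) := by
  classical
  set e : ι ≃ Fin (Fintype.card ι) := Fintype.equivFin ι with he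
  -- the `Fin`-indexed version
  have h := hasSum_pi_prod (f := fun t : Fin (Fintype.card ι) => f (e.symm t)) (c := fun t => c (e.symm t))
    (fun t => hf _) (fun t => hn _)
  -- transport the index of summation along `(ι → ℕ) ≃ (Fin _ → ℕ)` and the product along `e`
  have hprodc : (∏ t : Fin (Fintype.card ι), c (e.symm t)) = ∏ i, c i :=
    Fintype.prod_equiv e.symm _ _ fun _ => rfl
  rw [hprodc] at h
  let E : (ι → ℕ) ≃ (Fin (Fintype.card ι) → ℕ) := Equiv.piCongrLeft' (fun _ : ι => ℕ) e
  have hfun : (fun k : ι → ℕ => ∏ i, f i (k i)) =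
      (fun k' : Fin (Fintype.card ι) → ℕ => ∏ t, f (e.symm t) (k' t)) ∘ E := by
    funext k
    simp only [Function.comp, E, Equiv.piCongrLeft'_apply]
    exact (Fintype.prod_equiv e.symm (fun t => f (e.symm t) (k (e.symm t))) (fun i => f i (k i)) fun _ => rfl).symm
  rw [hfun, E.hasSum_iff]
  exact h

end FintypeProd

/-! ## §24 Resummation of the pair-chain integrand -/

section ChainResum

variable {S : ℕ} [NeZero S] {G : Type} [Group G] {Nc : ℕ} (ρ : G →* Matrix (Fin Nc) (Fin Nc) ℂ)

/-- ★ **The pair-chain integrand through the feature lift** (`β ≥ 0`, unitary `ρ`): for any finite index type `ι` with a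
"next" map `σ` and half-layer data `Y X : ι → HalfCfg`,
`∏_i e^{β even(Y_i, X_i, Y_{σ i})} e^{β odd(X_i, Y_{σ i}, X_{σ i})}
 = Σ_{k ∈ ℕ^ι} ∏_i e^{β inslab X_i} ψ_{k_i}(w(ΘY_{σ i})) ψ_{k_i}(w(Y_i)) e^{β odd(X_i, Y_{σ i}, X_{σ i})}` — the summand is the cyclic
product of the factors of the lifted kernel `𝔞` before the `Y`-integrations (S4c of the trace formula). -/
theorem hasSum_chainIntegrand {β : ℝ} (hβ : 0 ≤ β) (hρu : ∀ g, ρ g ∈ Matrix.unitaryGroup (Fin Nc) ℂ)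
    {ι : Type*} [Fintype ι] (σ : ι → ι) (Y X : ι → HalfCfg S S G) :
    HasSum (fun k : ι → ℕ => ∏ i, Real.exp (β * inslabAction ρ (X i)) *
        (natFeature (p := featDim S Nc) β (k i) (bondVec ρ (thetaHalf (Y (σ i)))) *
          natFeature (p := featDim S Nc) β (k i) (bondVec ρ (Y i))) *
        Real.exp (β * oddActionU ρ (X i) (Y (σ i)) (X (σ i))))
      (∏ i, Real.exp (β * evenActionU ρ (Y i) (X i) (Y (σ i))) * Real.exp (β * oddActionU ρ (X i) (Y (σ i)) (X (σ i)))) := by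
  refine hasSum_pi_prod_fintype (f := fun i k => Real.exp (β * inslabAction ρ (X i)) *
      (natFeature (p := featDim S Nc) β k (bondVec ρ (thetaHalf (Y (σ i)))) * natFeature (p := featDim S Nc) β k (bondVec ρ (Y i))) *
      Real.exp (β * oddActionU ρ (X i) (Y (σ i)) (X (σ i)))) (fun i => ?_) (fun i => ?_)
  · -- the even weight through the ℕ-indexed feature lift
    have hev : evenActionU ρ (Y i) (X i) (Y (σ i)) =
        (∑ j, bondVec ρ (thetaHalf (Y (σ i))) j * bondVec ρ (Y i) j) + inslabAction ρ (X i) := by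
      rw [← evenActionU_thetaHalf_eq_sum_bondVec ρ hρu (Y i) (X i) (thetaHalf (Y (σ i))), thetaHalf_thetaHalf]
    have h := ((hasSum_natFeature_mul hβ (bondVec ρ (thetaHalf (Y (σ i)))) (bondVec ρ (Y i))).mul_left
      (Real.exp (β * inslabAction ρ (X i)))).mul_right (Real.exp (β * oddActionU ρ (X i) (Y (σ i)) (X (σ i))))
    rw [hev, mul_add, Real.exp_add, mul_comm (Real.exp (β * ∑ j, _)) _]
    exact h
  · have h := ((summable_norm_natFeature_mul hβ (bondVec ρ (thetaHalf (Y (σ i)))) (bondVec ρ (Y i))).mul_left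
      ‖Real.exp (β * inslabAction ρ (X i))‖).mul_right ‖Real.exp (β * oddActionU ρ (X i) (Y (σ i)) (X (σ i)))‖
    refine h.congr fun k => ?_
    simp only [norm_mul]

end ChainResum

end Summit.QuantumFields.YangMills.Cruxes.DiagonalMirrorRPR.SignTwistedDiagonalTrace.WilsonDiagonal

end
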